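import Mathlib
import HarnessLib
import HarnessLib.Audit
import Summits.RiemannHypothesis.Statement
import Summits.RiemannHypothesis.RiemannHypothesis.Theorems.ScrewManifestCertTopBlock
import Summits.RiemannHypothesis.RiemannHypothesis.Theorems.ScrewManifestCertDefs
import HarnessLib.Audit.Status.Attr

/-!
Route: ScrewNyquistFloor

CLOSED (proved) 2026-08-26T15:13:18Z by operator:999:484807 — reason: proved:Summit.RiemannHypothesis.RiemannHypothesis.Theorems.IntegerScrew.Manifest.nyquistFloor_holds. The file is kept as the record of this route; refuted decls are indexed as negative knowledge (`ledger negatives`).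

# Route ScrewNyquistFloor — Nyquist floor for manifest SOS certificates of the screw matrices via
one 110-edge integer dual

Column SCREW of the RH ladder, rung S-P(P3) (D-0040/D-0059/D-0061). The DOOR is Suzuki's criterion
`RH ↔ ∀ M, S_M ≻ 0`
for the screw matrices `S_M = (Ψ(log(m/n)))` (tree: `riemannHypothesis_iff_screwMatrix_posDef`,
route `IntegerScrew`; RH-EQUIVALENT,
not an item here). This route closes the RUNG LEAF `Manifest.NyquistFloor` — the RH-FREE OBSTRUCTION
LAW for the structured-SOS
("manifest wave") certificate format of the SOS census: `∃ c > 0, ∀ M ≥ 8, every manifest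
certificate of S_M with wave
frequencies in [t_min, T] has T ≥ c·M` (band-limited waves cannot resolve the `1/M`-spaced top
nodes). It suffices to show
X = TopBlockNeg31 ∧ TopBlockWavePos31: the fixed 110-edge integer design `D16 = (a_e, b_e, k_e)` on
the top 16 nodes pairs
NEGATIVELY with `S_N` for every `N ≥ 31` and NONNEGATIVELY with every wave atom of frequency `t ≤
0.42(N − 8)`; the landed
soundness theorem `Manifest.nyquistFloor_of_D16'` (dual8 block `M = 8…31` already kernel-proved
inside it) turns X into the leaf.
Lean: `Summit.RiemannHypothesis.RiemannHypothesis.Theorems.IntegerScrew.Manifest.NyquistFloor`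

## Assembly
Pure logic on top of the landed soundness chain of `Theorems/ScrewManifestCert.lean` (module 7 of
the cut): `nyquistFloor_of_D16' : TopBlockD16Works →
NyquistFloor` with `TopBlockD16Works = TopBlockPairingNeg 31 ∧ TopBlockWavePos (21/50) 8 31` (weak
duality `dual_blocks_manifestCert`
+ DD*-membership `topBlockDDStar_holds` + the `M = 8…31` block `floorAtEight_20`, all PROVED there,
standard axioms). The Assembly
item is provable the moment the route is born (one-line Theorems file); `closes hneg hpos hA := hA
hneg hpos`.

CLOSES_TARGET: closes rung S-P(P3) of RiemannHypothesis: Summit.RiemannHypothesis.RiemannHypothesis.Theorems.IntegerScrew.Manifest.NyquistFloor (D-0061; not the summit Statement) — the deciding theorem of this route concludes that registered leaf instead of the Statement decl `RiemannHypothesis` (class rung: servable and labelled, never counted as concluding the summit Statement).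

Rationale: WHY THIS LINE. A manifest certificate writes `S_{n+1} = Σ_k w_k A_{t_k} + w_J J + R` with PSD wave
atoms `A_t` (frequencies `t ≤ T`), `J` the
all-ones matrix and `R` strictly diagonally dominant; a DUAL is a symmetric `Y` supported on the top
block with zero row sums
(kills `J`), `⟨A_t, Y⟩ ≥ 0` for `0 < t ≤ θ(N − s)` and `⟨R, Y⟩ ≥ 0` for every strictly-DD `R` (the
DD*-cone condition, PROVED for
`D16` as `Manifest.topBlockDDStar_holds`), yet `⟨S_N, Y⟩ < 0` — so no certificate exists below
height `θ(N − s)`, and `c = θ/30`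
works for all `M ≥ 8` once the block `M = 8…31` is covered (`Manifest.floorAtEight_20`, PROVED: one
`M = 8` dual at `T = 20`).
The design `D16` was found by LP over integer edge-Laplacians (HOME/sos/SCREW-NYQUIST-DUAL-R2.md,
gen14–16); in the scaling
`(φ, x) = (t/N, 1/N)` both inequalities become statements about ONE explicit trigonometric / `Ψ`-sum
on a compact
two-parameter set plus an `N → ∞` germ, i.e. interval arithmetic of the kind the tree already runs
(`IntegerScrewRungCert*`,
`IntegerScrewRung128`). Imported from signal analysis: the Nyquist/large-sieve threshold `T ≍ N` for
resolving the
frequencies `log n`, `n ≤ N` (Montgomery–Vaughan mean value theorem, Ivić 1985 Thm 5.2) — here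
turned into a one-sided,
kernel-checkable SOS obstruction with an explicit constant. No prior route states or attacks an
obstruction law for the
census format; the negatives index (2 entries: a character-sum sign claim, a universal-factor
Laplace loophole) is untouched.

RANKED CRUXES. #2 TopBlockNeg31 (crux) — P-NEG. For every `N ≥ 31` the pairing of the design with
the screw matrix is negative: `G_N = Σ_e k_e Ψ(log(N − a_e) − log(N − b_e)) < 0` (110 edges, `0 ≤
a_e < b_e ≤ 15`, integer `k_e`, `Σ k_e = 77 911`); equivalently `N·G_N ≤ (S₁/2) log N + A_∞ + o(1) <
0` with `S₁ = Σ k_e (b_e − a_e) < 0`. [difficulty: L] (why it might fail: FLOAT margin is only N·G_N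
≤ −0.00438 at N = 31 (0.4 % of Σ|k_e|·max|Ψ|); an every-N scan to 10⁵ and the asymptotic sign are
float-only beyond N = 128 — a cell of the FI checker in 129 ≤ N ≤ 10⁴ could fail to certify and
force a re-cut or a new design.) [Suzuki2023, arXiv:2206.03682, HOME/sos/SCREW-NYQUIST-DUAL-R2.md,
HOME/rh-explicit-sos-eng-1/code/pneg/P-NEG-DESIGN.md]
#3 TopBlockWavePos31 (crux) — P-POS. For every `N ≥ 31` and every frequency `0 < t ≤ (21/50)(N − 8)`
the design pairs nonnegatively with the wave atom: `Σ_e k_e (1 − cos(t·(log(N − a_e) − log(N −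
b_e)))) ≥ 0`; in the variables `(φ, x) = (t/N, 1/N) ∈ (0, 0.42] × (0, 1/31]` this is one inequality
`F(φ, x) ≥ 0` for an explicit finite trigonometric sum, with `F(φ, 0) > 0` on `(0, 0.4535)`.
[difficulty: L] (why it might fail: the certified grid (21 797 cells, second-order remainder, FLOAT)
has minimum margin 6.8·10⁻⁵ near φ ≈ 0.42, x ≈ 1/31; an interval re-run could lose a cell to
rounding, forcing θ = 21/50 down (the assembly tolerates any θ > 0 with s = 8 only through
`nyquistFloor_of_D16`, i.e. a restated crux).) [Suzuki2023, arXiv:2206.03682,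
HOME/sos/SCREW-NYQUIST-DUAL-R2.md, HOME/sos/nyquist-dual/D16.json]

TWO-LAYER PLAN. Foreseen glued splits (filed only when a seat asks): `TopBlockNeg31 ⇐ Head (31 ≤ N ≤
128, tree table of S_128; sos-eng-1's
`topPairing_neg_of_le_128` is READY) → Cells (129 ≤ N ≤ 10⁵, FI cell checker on h(N) = N·G_N with
the closed forms Ψ′, Ψ″, Ψ‴ of
`IntegerScrewPsiDeriv` p406203 and the small-argument expansion p406321) → Tail (N > 10⁵, sign of
(S₁/2) log N + A_∞ + O(1/N))`;
`TopBlockWavePos31 ⇐ SmallPhase (0 < t ≤ 0.0344·N, second-order Taylor, S₂(x) ≥ 0.345) → GridPhase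
(0.0344·N ≤ t ≤ 0.42(N − 8),
two-variable interval grid with Hessian bounds 56.4 / 359.2 / 2551.7)`. Both splits are the
registered birth skeletons (bc/).

KILL CRITERIA. A kernel counterexample `N₀ ≥ 31` with `G_{N₀} ≥ 0` refutes TopBlockNeg31 and a pair
`(N₀, t₀)` with negative wave pairing refutes
TopBlockWavePos31: either closes THIS route (`close --reason refuted:<Decl>`) but NOT the leaf — the
pivot is a re-solved design
(larger block L, smaller θ) filed as a new route on the same leaf (D-0061 alt-closer). A proof of
`¬NyquistFloor` (certificates at
height o(M)) would moot the whole line and contradict the census (T_DD(M)/M ∈ [2.6, 3.9] for M =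
8…112). A proof of NyquistFloor by
an analytic large-sieve argument elsewhere supersedes it (`--reason superseded`).

NOT DECOMPOSED YET. The cell boundaries of the P-NEG checker (≈ 30–45 cells, chosen by the prover's
FI widths), the Lipschitz-in-x constants of the
P-POS grid, the `N > 10⁵` germ constants (A_∞, S₂⁺, S₃⁺) and the bridge lemma
`TopBlockNeg.topPairing N = Σ_e tbC e · Ψ(tbD N e)`
(list form ↔ `Fin 110` sum; definitional) are layer-2 lemmas attached with `--supports`, not items.

CHEAPEST FALSIFIER. Evaluate `G_N` for `N = 31…40` from the tree's certified `S_128` table (one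
`decide`, 21 s): done — sos-eng-1 gen10
`topPairing_neg_of_headCheck … headCheck_utab127` certifies `G_N < 0` for ALL `31 ≤ N ≤ 128` (farm
rc 0, 0 sorry; copy
bc/TopBlockNeg31_rung_head.lean). For P-POS: the single point `(φ, x) = (0.42, 1/31)` (the grid's
minimum-margin corner) in
interval arithmetic — FLOAT value `+6.8·10⁻⁵·(scale)`, not yet run in FI.

NUMBERS. Design D16: L = 16 nodes, 110 edges, Σ k_e = 77 911, θ = 21/50, shift s = 8, N₀ = 31,
implied floor constant c = θ/30 = 0.014
(census slope 2.6–3.9: the constant is not the point, linearity in M is). FLOAT margins (gen16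
verify3.py): N·G_N ≤ −0.00438 (N = 31),
≤ −0.0273 (N ≥ 1.2·10⁴); wave grid min margin 6.8·10⁻⁵; Taylor strip φ ≤ 0.0344 with S₂ ≥ 0.345;
first zero of the x = 0 profile
φ* = 0.4535 (method ceiling θ < φ*). Dual8 (M = 8): T₈ = 20, PROVED. Census brackets REF-PASSED:
T_DD(48) ∈ (170,175], T_DD(64) ∈
(235,240], T_DD(96) ∈ (375,380], T_DD(112) ∈ (440,445].

DEFINITION REQUESTS. None: every notion is in the tree modules
`Theorems/ScrewManifestCert{Defs,Dual,TopBlock,Residual,Dual8,WaveChecker,}.lean` (the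
7-module cut of HOME/sos/lean/ScrewManifestCert.lean v1.5, sha256 905d43e0…, declarations
byte-identical, farm rc 0 / 0 sorry; filed by a
prover seat — planner filing is refused `perm.theorems-prover-only`; `NyquistFloor` in `…Defs`,
`tbC/tbD` in `…TopBlock`,
`nyquistFloor_of_D16'` in `ScrewManifestCert`) and `Literature.NumberTheory.LFunctions.ZetaScrew`.

Novelty: Searches (2026-08-25): `lit search --hybrid "screw function Riemann zeta positive definite Suzuki"`
(8 docs; relevant: [corpus:paper:galaxy-pdf-4095684125908136320 p.1] screw line function on function
fields 2024, Ivić 1985); `lit search "mean value" "Dirichlet polynomial" Montgomery Vaughan Hilbert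
inequality --source local` (2 papers citing MV74); `lit vsearch "mean value theorem for Dirichlet
polynomials … T + O(N) …" --books` (8;
[corpus:book:ivic1985-riemann-zeta-function-theory-applications p.105 Thm 5.2]); `lit galaxy search
"screw function|screw line|Kreĭn screw" --star all` (30 rows, all mechanical-engineering noise: no
relevant hit); `lit galaxy search "Beurling-Selberg|Hilbert's inequality|Montgomery-Vaughan" --star
pdf` (8; [galaxy:pdf:9059879779722682800] Bondarenko–Ivić–Saksman–Seip, sums over ordinates —
tangential); `ledger negatives --problem RiemannHypothesis` (2, unrelated); `lean search
TopBlockPairingNeg|NyquistFloor` (HOME file only).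
Nearest prior art found: Suzuki2023 (doi:10.1112/jlms.12785) Thm 1.1–1.2 (the screw criterion; no
statement about certificate bandwidth);
[corpus:book:ivic1985-riemann-zeta-function-theory-applications p.105 Thm 5.2] (Montgomery–Vaughan:
`∫₀^T |Σ a_n n^{it}|² = T Σ|a_n|² + O(Σ n|a_n|²)`, the `T ≍ N` resolution threshold for the
frequencies log n); in-house: HOME/sos/SCREW-NYQUIST-DUAL-R2.md (the design), K-SOS-1 / BARRIER-SOS
B1–B6 (LADDER-RH row S-P).
Delta: the resolution threshold `T ≍ N` is turned into an explicit, M-un  [refs: 10.1112/jlms.12785, paper:galaxy-pdf-4095684125908136320, book:ivic1985-riemann-zeta-function-theory-applications, doi:10.1112/jlms.12785, Suzuki2023]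

Barriers (technique_class: sos-dual-certificate, interval-arithmetic, trig-positivity): - technique_class: sos-dual-certificate, interval-arithmetic, trig-positivity
- Literature.Barriers.RiemannHypothesis.DeBrangesPositivity: outside — the leaf is an OBSTRUCTION
(no certificate below c·M), not a positivity claim; nothing uses de Branges' condition (3.1) or the
space 𝓗(E); Conrey–Li's failure and this floor point the same way (negative results about positivity
architectures).
- Literature.Barriers.RiemannHypothesis.NymanBeurlingObstructions: outside — other column (L² Möbius
approximation rates); parallel in kind (an unconditional no-go inside an RH-equivalent criterion)
but it does not quantify over screw matrices or wave certificates.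
- Literature.Barriers.RiemannHypothesis.TuranPartialSums, .MollifierLimitations, .LindelofBacklund:
outside — no Dirichlet-polynomial zero location, no mollified moment, no size-to-zero-free upgrade;
the conclusion is two families of explicit finite inequalities.
- BARRIER-SOS B1–B6 (K-SOS-1, LADDER-RH row S-P: «every FIXED RH-free certificate architecture fails
M-uniformly»): the route sits ON the barrier side — NyquistFloor is the quantitative theorem-form of
that barrier for the manifest format; closing it beats no barrier, it certifies one. Summit credit:
none (D-0061 rung leaf, RH-FREE).
- Negatives index: 2 refuted statements (CharacterSumsConreyPositivity,
UniversalFactorLaplaceLoophole) — neither concerns screw matrices, wave atoms or Ψ; nothing to steer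
around.

History (route lifecycle, newest last):
- 2026-08-26T15:13:18Z · CLOSED proved — proved:Summit.RiemannHypothesis.RiemannHypothesis.Theorems.IntegerScrew.Manifest.nyquistFloor_holds (operator:999:484807)

sub-problem: RiemannHypothesis · status: closed(proved) · opened planner-rh-explicit-sos-theory-g17-0 2026-08-25T23:30:36Z · rev 1 · ledger route-RiemannHypothesis-ScrewNyquistFloor
GENERATED by the gate from the ledger (D-0016/17). Provers cite these decls: `theorem foo : Summit.RiemannHypothesis.RiemannHypothesis.Theses.ScrewNyquistFloor.<Decl> := …` in Summits/RiemannHypothesis/RiemannHypothesis/Theorems/<Name>.lean.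
-/

namespace Summit.RiemannHypothesis.RiemannHypothesis.Theses.ScrewNyquistFloor

open scoped BigOperators Topology Manifold Classical MeasureTheory ProbabilityTheory Matrix InnerProductSpace ComplexConjugate ContinuousMap
open Filter Set Function TopologicalSpace MeasureTheory

attribute [summit_statement] _root_.Summit.RiemannHypothesis
attribute [summit_statement] _root_.Summit.RiemannHypothesis.RiemannHypothesis.Theorems.IntegerScrew.Manifest.NyquistFloor

open Summit

/-- item stmt-RiemannHypothesis-20030 · crux · rank 2 · closed · proved by Summit.RiemannHypothesis.RiemannHypothesis.Theorems.IntegerScrew.TopBlockNeg.topBlockNeg31 (prover) · by planner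
why it might fail: FLOAT margin is only N·G_N ≤ −0.00438 at N = 31 (0.4 % of Σ|k_e|·max|Ψ|); an every-N scan to 10⁵ and the asymptotic sign are float-only beyond N = 128 — a cell of the FI checker in 129 ≤ N ≤ 10⁴ could fail to certify and force a re-cut or a new design.
sources: Suzuki2023, arXiv:2206.03682, HOME/sos/SCREW-NYQUIST-DUAL-R2.md, HOME/rh-explicit-sos-eng-1/code/pneg/P-NEG-DESIGN.md
[crux] P-NEG. For every `N ≥ 31` the pairing of the design with the screw matrix is negative: `G_N =
Σ_e k_e Ψ(log(N − a_e) − log(N − b_e)) < 0` (110 edges, `0 ≤ a_e < b_e ≤ 15`, integer `k_e`, `Σ k_e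
= 77 911`); equivalently `N·G_N ≤ (S₁/2) log N + A_∞ + o(1) < 0` with `S₁ = Σ k_e (b_e − a_e) < 0`.
[difficulty: L] -/
@[route_item "route-RiemannHypothesis-ScrewNyquistFloor", crux]
def TopBlockNeg31 : Prop :=
  ∀ N : ℕ, 31 ≤ N → ∑ e, Summit.RiemannHypothesis.RiemannHypothesis.Theorems.IntegerScrew.Manifest.tbC e * Literature.NumberTheory.LFunctions.zetaScrew (Summit.RiemannHypothesis.RiemannHypothesis.Theorems.IntegerScrew.Manifest.tbD N e) < 0

-- `TopBlockNeg31` holds: proved by `Summit.RiemannHypothesis.RiemannHypothesis.Theorems.IntegerScrew.TopBlockNeg.topBlockNeg31` (its module imports this route file, so no `_holds` link can be stated here).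

/-- item stmt-RiemannHypothesis-20031 · crux · rank 3 · closed · proved by Summit.RiemannHypothesis.RiemannHypothesis.Theorems.IntegerScrew.TopBlockPos.topBlockWavePos31 (prover) · by planner
why it might fail: the certified grid (21 797 cells, second-order remainder, FLOAT) has minimum margin 6.8·10⁻⁵ near φ ≈ 0.42, x ≈ 1/31; an interval re-run could lose a cell to rounding, forcing θ = 21/50 down (the assembly tolerates any θ > 0 with s = 8 only through `nyquistFloor_of_D16`, i.e. a restated crux).
sources: Suzuki2023, arXiv:2206.03682, HOME/sos/SCREW-NYQUIST-DUAL-R2.md, HOME/sos/nyquist-dual/D16.json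
[crux] P-POS. For every `N ≥ 31` and every frequency `0 < t ≤ (21/50)(N − 8)` the design pairs
nonnegatively with the wave atom: `Σ_e k_e (1 − cos(t·(log(N − a_e) − log(N − b_e)))) ≥ 0`; in the
variables `(φ, x) = (t/N, 1/N) ∈ (0, 0.42] × (0, 1/31]` this is one inequality `F(φ, x) ≥ 0` for an
explicit finite trigonometric sum, with `F(φ, 0) > 0` on `(0, 0.4535)`. [difficulty: L] -/
@[route_item "route-RiemannHypothesis-ScrewNyquistFloor", crux]
def TopBlockWavePos31 : Prop :=
  ∀ N : ℕ, 31 ≤ N → ∀ t : ℝ, 0 < t → t ≤ 21 / 50 * ((N : ℝ) - 8) → 0 ≤ ∑ e, Summit.RiemannHypothesis.RiemannHypothesis.Theorems.IntegerScrew.Manifest.tbC e * (1 - Real.cos (t * Summit.RiemannHypothesis.RiemannHypothesis.Theorems.IntegerScrew.Manifest.tbD N e))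

-- `TopBlockWavePos31` holds: proved by `Summit.RiemannHypothesis.RiemannHypothesis.Theorems.IntegerScrew.TopBlockPos.topBlockWavePos31` (its module imports this route file, so no `_holds` link can be stated here).

/-- item stmt-RiemannHypothesis-20032 · assembly · rank 1 · closed · proved by Summit.RiemannHypothesis.RiemannHypothesis.Theorems.IntegerScrew.Manifest.screwNyquistFloorAssembly_proof (prover) · by planner
sources: Suzuki2023, HOME/sos/lean/ScrewManifestCert.lean
[assembly] TopBlockNeg31 → TopBlockWavePos31 → NyquistFloor (apply `Manifest.nyquistFloor_of_D16'`
to the pair). -/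
@[route_item "route-RiemannHypothesis-ScrewNyquistFloor", crux]
def Assembly : Prop :=
  TopBlockNeg31 → TopBlockWavePos31 → Summit.RiemannHypothesis.RiemannHypothesis.Theorems.IntegerScrew.Manifest.NyquistFloor

-- `Assembly` holds: proved by `Summit.RiemannHypothesis.RiemannHypothesis.Theorems.IntegerScrew.Manifest.screwNyquistFloorAssembly_proof` (its module imports this route file, so no `_holds` link can be stated here).

/-! D-0027 §2.1 — DECIDING THEOREM (planner-authored via `route open/edit --closes-file`; by planner-rh-explicit-sos-theory-g17-0 2026-08-25T23:30:36Z) — ARCHIVED: route closed (proved) 2026-08-26T15:13:18Z; kept so importers keep building: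
its hypotheses are this route's items and its conclusion the registered leaf `Summit.RiemannHypothesis.RiemannHypothesis.Theorems.IntegerScrew.Manifest.NyquistFloor` (rung S-P(P3), D-0061) (glue_lint), and it elaborates with this file. -/

@[closes "route-RiemannHypothesis-ScrewNyquistFloor"] theorem closes (hneg : TopBlockNeg31) (hpos : TopBlockWavePos31) (hA : Assembly) :
    Summit.RiemannHypothesis.RiemannHypothesis.Theorems.IntegerScrew.Manifest.NyquistFloor :=
  hA hneg hpos

end Summit.RiemannHypothesis.RiemannHypothesis.Theses.ScrewNyquistFloor
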